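import Summits.BirchSwinnertonDyer.BirchSwinnertonDyer.Theorems.GenusKolyvaginAtTwoPowDvdShaCardAtTwoRTRankDescentRankLeOne
import Summits.BirchSwinnertonDyer.BirchSwinnertonDyer.Theorems.GenusKolyvaginAtTwoPowDvdShaCardAtTwoRTOrthogonalCapstoneRankLeOne
import Summits.BirchSwinnertonDyer.BirchSwinnertonDyer.Theorems.GenusKolyvaginAtTwoPowDvdShaCardAtTwoRTPowDvdShaCardOfGrossWitnessOrthL
import Summits.BirchSwinnertonDyer.BirchSwinnertonDyer.Theorems.GenusKolyvaginAtTwoPowDvdShaCardAtTwoRTStubCtOrthogonalAtTwo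
import HarnessLib

/-!
# Route `GenusKolyvaginAtTwo`, LINE 18 `plus_descent` v6 «E4» — **THE CRUX L_T `PowDvdShaCardAtTwoRT` (stmt-BirchSwinnertonDyer-23659,
# ex 23299/23242) BY NAME, UNCONDITIONALLY**: `2^{2M₀} ∣ #Ш(E_K)[2^∞]` on L_T's habitat, from the in-statement antecedents Q2, Q5R, Q1 alone

Seat `bsd-line-gk2-p4` g21 (WIDTH-5 attach, cell `bsd-f1-sign2`), `--workitem stmt-BirchSwinnertonDyer-23659`.  THEOREMS ONLY (no definition,
no named fact, no `sorry`).  **BSD is NOT proved by this file**; neither is the parent Q3R_T (`EquivariantKolyvaginExactAtTwoRT`, which also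
needs the upper half U_T `ShaCardDvdPowAtTwoRT`) nor the route's deciding theorem.  What IS proved: the route item L_T — the LOWER /
exhibition half of Kolyvagin's structure theorem at `p = 2` on the habitat, `2^{2M₀} ∣ #Ш(E/K)[2^∞]` — with NO print bundle.

THE COMPOSITION (LEAD ruling R5 = gk2-p2's skeleton «E4», with stub P REMOVED):
* W-UP′ `stub_grossWitnessAtTwo` := `⟨n, d, hn, hKoly, hPn⟩` (`exact` under the route's rev-37 restate (β″): the crux's witness IS a
  level-2 Gross witness);
* X-ORTH∃ `stub_ctOrthogonalAtTwo` := gk2-p5 g27's `…RTStubCtOrthogonalAtTwo` (p739559 →  Socket → Stub), here re-cut WITHOUT its idle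
  `PubInputsAtTwo` binder (`ctOrthogonalAtTwo_of_frame`, proof verbatim: the Cassels–Tate level pairing of the canonical invariant maps,
  `ctLevelPairing_hOrth_of_kolyvagin_provenance` over gk2-p4 g20's cross-term vanishing);
* KS with provenance := gk2-p2/gk2-p3/LEAD/gk2-p5 `kolyvaginSuppliesAtTwo_of_grossWitness_onHabitat_pred` (p738269; exact swap `deepSwap_socket`,
  bottom rung `hbot_socket_margin_onHabitat_of_three_le`, `hK_socket_margin`, (NPh) from the odd multiplicative prime);
* the K-side capstone := `pow_dvd_natCard_sha_of_kolyvaginSupplies_of_orthogonal_of_rank_le_one` (p741898 = gk2-p2's p737814 with the print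
  bundle replaced by `rank E(K) ≤ 1`);
* **`rank E(K) ≤ 1` := `mordellWeilRank_baseChange_le_one_onHabitat`** (`…RTRankDescentRankLeOne`, this seat: Kolyvagin's rank descent AT `2`
  on the habitat — Gross 1991 Claims 10.1/10.3 at level `2^{2M₀+5}` from Q2, Q5R, (NPh) and the LINE's local eigen-duality law).
Stub P `stub_pubInputsAtTwo : PubInputsAtTwo` (Gross–Zagier ∧ Kolyvagin 1990 ∧ GZK ∧ modularity ∧ Milne) is NOT used: of it, road (E4) consumed
only «rank E(K) ≤ 1», now a theorem.

References: [McCallumLMS1991] §4 Prop. 4.7, §5 Prop. 5.2, Thm. 5.4; [Kolyvagin1991StructureSha]; [Kolyvagin1991MathAnn] Thm. 2.1–2.2;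
[GrossLMS1991] §1 Thm. 1.3, §3, §5 Props. 5.3–5.4, §10; [LawsonWuthrich2016] §7.1; [MilneADT2006] Ch. I §6 Lemma 6.17; [Cassels1962ArithmeticIV] §1.
-/

set_option autoImplicit false
-- the Theorems namespace of this sub repeats the summit name by design (D-0017 nested layout)
set_option linter.dupNamespace false

noncomputable section

open scoped Classical
open scoped AddSubgroup
open Function Field NumberField IsDedekindDomain WeierstrassCurve
open Literature.NumberTheory.EllipticCurves Literature.NumberTheory.GaloisRepresentations
open Literature.NumberTheory.EllipticCurves.ModularForms
open Literature.NumberTheory.GaloisCohomology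
open Summit.BirchSwinnertonDyer.Rank1Residual.JET.GlobalDuality
open Summit.BirchSwinnertonDyer.BirchSwinnertonDyer.Theses.GenusKolyvaginAtTwo
open Summit.BirchSwinnertonDyer.BirchSwinnertonDyer.Theorems.GenusExact.PlusDescent

namespace Summit.BirchSwinnertonDyer.BirchSwinnertonDyer.Theorems

/-! ## §1 X-ORTH∃ without the idle print binder (gk2-p5's `stub_ctOrthogonalAtTwo`, proof verbatim) -/

/-- **X-ORTH∃ on L_T's frame** — gk2-p5 g27's `stub_ctOrthogonalAtTwo` (`…RTStubCtOrthogonalAtTwo`) with its unused first binder `PubInputsAtTwo`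
dropped and the frame binders it does not use dropped too: for `τ ≠ 1` and `k ≥ 1`, the level-`2^k` Cassels–Tate pairing `B` of the canonical
invariant maps on `Ш(E_K)[2^k]` satisfies the level clause and kills (+)-provenance × (−)-provenance Kolyvagin classes at class level `2^(2k)`.
(Proof adapted verbatim from `…RTStubCtOrthogonalAtTwo`, gk2-p5 g27.) [cite: McCallumLMS1991, §4 Prop. 4.7, §5 Lemma 5.3]
[cite: MilneADT2006, Ch. I §6 Prop. 6.9, Lemma 6.17] [cite: Cassels1962ArithmeticIV, §1] [cite: GrossLMS1991, Prop. 5.4, Prop. 6.2] -/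
theorem GenusExact.PlusDescent.ctOrthogonalAtTwo_of_frame (W : WeierstrassCurve ℚ) [W.IsElliptic] [W.IsGloballyMinimal] [NeZero (W.conductorNorm ℤ)]
    (hT : Odd W.tamagawaProduct) (hneg : W.Δ < 0) (K : Type) [Field K] [NumberField K] (hIQ : IsImaginaryQuadratic K)
    (hodd : Odd (NumberField.discr K)) (h3 : NumberField.discr K ≠ -3) (hHe : SatisfiesHeegnerHypothesis (W.conductorNorm ℤ) K)
    (hρ : ∀ n : ℕ, 0 < n → W.HasSurjectiveModNGaloisRep ((2 : ℤ) ^ n))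
    (Dt : ModularParametrizationData W (W.conductorNorm ℤ)) (β : ℤ) (ι : K →+* ℂ) (τ : K ≃ₐ[ℚ] K) (hτ : τ ≠ 1) (k : ℕ) (hk1 : 1 ≤ k) :
    ∃ B : ↥((↥(W.baseChange K).sha)[((2 ^ k : ℕ) : ℤ)]) →+ ↥((↥(W.baseChange K).sha)[((2 ^ k : ℕ) : ℤ)]) →+ AddCircle (1 : ℚ),
      (∀ x : ↥((↥(W.baseChange K).sha)[((2 ^ k : ℕ) : ℤ)]), B x = 0 →
        ∃ z : (W.baseChange K).sha, (2 ^ k) • z = (x : (W.baseChange K).sha)) ∧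
      (∀ x x' : ↥((↥(W.baseChange K).sha)[((2 ^ k : ℕ) : ℤ)]),
      (∃ (n : ℕ) (d : KolyvaginHeegnerData Dt β ι n) (e : ℕ), Squarefree n ∧
        (∀ ℓ ∈ n.primeFactors, Zhang2014.IsKolyvaginPrime (W.conductorNorm ℤ) W K 2 ℓ ∧ 2 * k ≤ Zhang2014.kolyvaginIndex W 2 ℓ ∧
          FrobEqFrobInfty W K (2 ^ (2 * k)) ℓ) ∧
        e ≤ k ∧
        ((2 ^ (2 * k - e) : ℕ) : ℤ) • d.kolyvaginClass Nat.prime_two (2 * k) ∈ selmerGroup (W.baseChange K) ((2 ^ (2 * k) : ℕ) : ℤ) ∧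
        (∀ ℓ ∈ n.primeFactors, ∀ u : HeightOneSpectrum (𝓞 K), ((ℓ : ℕ) : 𝓞 K) ∈ u.asIdeal →
          ((2 ^ (2 * k - e) : ℕ) : ℤ) • d.kolyvaginClass Nat.prime_two (2 * k) ∈
            (W.baseChange K).torsionLocalKer (u.adicCompletion K) ((2 ^ (2 * k) : ℕ) : ℤ)) ∧
        conjAct W τ ((2 ^ (2 * k) : ℕ) : ℤ) (((2 ^ (2 * k - e) : ℕ) : ℤ) • d.kolyvaginClass Nat.prime_two (2 * k)) =
          W.rootNumber • (((2 ^ (2 * k - e) : ℕ) : ℤ) • d.kolyvaginClass Nat.prime_two (2 * k)) ∧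
        ((x : (W.baseChange K).sha) : (W.baseChange K).galH1) =
          torsionH1ToH1 (W.baseChange K) ((2 ^ (2 * k) : ℕ) : ℤ) (((2 ^ (2 * k - e) : ℕ) : ℤ) • d.kolyvaginClass Nat.prime_two (2 * k))) →
      (∃ (n : ℕ) (d : KolyvaginHeegnerData Dt β ι n) (e : ℕ), Squarefree n ∧
        (∀ ℓ ∈ n.primeFactors, Zhang2014.IsKolyvaginPrime (W.conductorNorm ℤ) W K 2 ℓ ∧ 2 * k ≤ Zhang2014.kolyvaginIndex W 2 ℓ ∧
          FrobEqFrobInfty W K (2 ^ (2 * k)) ℓ) ∧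
        e ≤ k ∧
        ((2 ^ (2 * k - e) : ℕ) : ℤ) • d.kolyvaginClass Nat.prime_two (2 * k) ∈ selmerGroup (W.baseChange K) ((2 ^ (2 * k) : ℕ) : ℤ) ∧
        (∀ ℓ ∈ n.primeFactors, ∀ u : HeightOneSpectrum (𝓞 K), ((ℓ : ℕ) : 𝓞 K) ∈ u.asIdeal →
          ((2 ^ (2 * k - e) : ℕ) : ℤ) • d.kolyvaginClass Nat.prime_two (2 * k) ∈
            (W.baseChange K).torsionLocalKer (u.adicCompletion K) ((2 ^ (2 * k) : ℕ) : ℤ)) ∧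
        conjAct W τ ((2 ^ (2 * k) : ℕ) : ℤ) (((2 ^ (2 * k - e) : ℕ) : ℤ) • d.kolyvaginClass Nat.prime_two (2 * k)) =
          (-W.rootNumber) • (((2 ^ (2 * k - e) : ℕ) : ℤ) • d.kolyvaginClass Nat.prime_two (2 * k)) ∧
        ((x' : (W.baseChange K).sha) : (W.baseChange K).galH1) =
          torsionH1ToH1 (W.baseChange K) ((2 ^ (2 * k) : ℕ) : ℤ) (((2 ^ (2 * k - e) : ℕ) : ℤ) • d.kolyvaginClass Nat.prime_two (2 * k))) →
      B x x' = 0) := by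
  haveI : Fact (Nat.Prime 2) := ⟨Nat.prime_two⟩
  haveI : IsTotallyComplex K := hIQ.2
  haveI hell : (W.baseChange K).IsElliptic := inferInstanceAs ((W.map (algebraMap ℚ K)).IsElliptic)
  haveI : NeZero (2 ^ k) := ⟨pow_ne_zero _ two_ne_zero⟩
  haveI : NeZero (2 ^ k * 2 ^ k) := ⟨mul_ne_zero (pow_ne_zero _ two_ne_zero) (pow_ne_zero _ two_ne_zero)⟩
  have hρ2 : W.HasSurjectiveModNGaloisRep 2 := by simpa using hρ 1 one_pos
  have h2N : 2 ≤ 2 ^ k * 2 ^ k := by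
    have h2 : 2 ≤ 2 ^ k := by
      calc (2 : ℕ) = 2 ^ 1 := by norm_num
        _ ≤ 2 ^ k := Nat.pow_le_pow_right (by norm_num) hk1
    nlinarith
  -- the Weil datum, equivariant under every lift of every `σ ∈ Aut(K/ℚ)`
  obtain ⟨e, hμ, hadd₁, hadd₂, halt, hnd, hgal, hlift⟩ := exists_weilPairing_liftEquivariant W K (2 ^ k * 2 ^ k) h2N
  -- the canonical invariant maps and the level pairing
  have hB := CasselsTateTotallyComplex.isLevelPairing_ctLevelPairing_canonical (W.baseChange K) 2 k e hμ hadd₁ hadd₂ hgal halt hnd hk1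
  refine ⟨ctLevelPairing (W.baseChange K) (2 ^ k) e hμ hadd₁ hadd₂ hgal (LocalInvariants.canonical K (2 ^ k * 2 ^ k)) halt
      (sumInvLocalizationEqZero_canonical_of_numberField K (2 ^ k * 2 ^ k))
      (CasselsTatePTc.shaThree_mu_eq_zero_of_isTotallyComplex (K := K) (2 ^ k * 2 ^ k))
      (localTerm_finite_support (W.baseChange K) (2 ^ k) e hμ hadd₁ hadd₂ hgal halt (LocalInvariants.canonical K (2 ^ k * 2 ^ k))),
    fun x hx ↦ (hB.2 x).mp fun y ↦ ?_, ?_⟩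
  · rw [hx, AddMonoidHom.zero_apply]
  · exact ctLevelPairing_hOrth_of_kolyvagin_provenance W K hIQ hneg hodd h3 hHe hT hρ2 τ hτ Dt β ι (2 * k) k rfl hk1 e hμ hadd₁ hadd₂
      hgal halt hlift (LocalInvariants.canonical K (2 ^ k * 2 ^ k)) (isConjCompatible_canonical τ (2 ^ k * 2 ^ k))
      (sumInvLocalizationEqZero_canonical_of_numberField K (2 ^ k * 2 ^ k))
      (CasselsTatePTc.shaThree_mu_eq_zero_of_isTotallyComplex (K := K) (2 ^ k * 2 ^ k))
      (localTerm_finite_support (W.baseChange K) (2 ^ k) e hμ hadd₁ hadd₂ hgal halt (LocalInvariants.canonical K (2 ^ k * 2 ^ k)))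

/-! ## §2 The crux L_T by name -/

/-- **L_T `PowDvdShaCardAtTwoRT` (stmt-BirchSwinnertonDyer-23659) PROVED: on the route's habitat, `2^{2M₀} ∣ #Ш(E/K)[2^∞]`** — the lower half of
Kolyvagin's structure theorem at `p = 2` — from the antecedents in its own statement (Q2 `KolyvaginRelationAtTwo`, Q5R `EquivariantChebotarevAtTwoR`,
the cyclicity clause Q1) and tree theorems; NO `PubInputsAtTwo`.  LINE 18 v6 «E4» composition (LEAD R5) with `k := M₀ + 6`, `L := 2k`, margin `1`:
W-UP′ = the crux's Gross witness itself; X-ORTH∃ = `ctOrthogonalAtTwo_of_frame`; KS with provenance = `kolyvaginSuppliesAtTwo_of_grossWitness_onHabitat_pred`;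
capstone = `pow_dvd_natCard_sha_of_kolyvaginSupplies_of_orthogonal_of_rank_le_one` fed with `mordellWeilRank_baseChange_le_one_onHabitat`.
BSD is NOT proved by this; neither is Q3R_T (needs U_T) nor the route's deciding theorem.
[cite: McCallumLMS1991, §5 Prop. 5.2, Thm. 5.4 (p. 310)] [cite: Kolyvagin1991StructureSha] [cite: Kolyvagin1991MathAnn, Thm. 2.1–2.2]
[cite: GrossLMS1991, §1 Thm. 1.3, §10] [cite: LawsonWuthrich2016, §7.1] -/
theorem powDvdShaCardAtTwoRT_proof : PowDvdShaCardAtTwoRT := by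
  intro hQ2 _hQ5R _hQ1 W _ _ _ hcm hT v h2v hNv hmult hneg K _ _ hIQ hodd h3 hHe hsq1 hsq2 hρ Dt β ι d₁ hy M₀ hdiv hndiv n d hn hKoly hPn
  haveI : Fact (Nat.Prime 2) := ⟨Nat.prime_two⟩
  have hsurN : ∀ m : ℕ, W.HasSurjectiveModNGaloisRep ((2 ^ m : ℕ) : ℤ) :=
    MinimalTwinBSDTwo.forall_hasSurjectiveModNGaloisRep_two_pow_of_pos W hρ
  have hsurN' : ∀ m : ℕ, W.HasSurjectiveModNGaloisRep (2 ^ m : ℕ) := fun m ↦ by exact_mod_cast hsurN m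
  -- the complex conjugation of `K`
  obtain ⟨τ, hτ, -⟩ := Literature.NumberTheory.EllipticCurves.exists_conj_of_isImaginaryQuadratic (K := K) hIQ
  -- `rank E(K) ≤ 1` — Kolyvagin's rank descent at `2` on the habitat (this seat), replacing the print bundle
  have hrk : (W.baseChange K).mordellWeilRank ≤ 1 :=
    mordellWeilRank_baseChange_le_one_onHabitat hQ2 W hcm hT v h2v hNv hmult hneg K hIQ hodd h3 hHe hsq1 hsq2 hρ Dt β ι d₁ M₀ hndiv
  -- X-ORTH∃ at `k := M₀ + 6` (gk2-p5's stub closer, hP-free)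
  obtain ⟨B, hker, hOrth⟩ := ctOrthogonalAtTwo_of_frame W hT hneg K hIQ hodd h3 hHe hρ Dt β ι τ hτ (M₀ + 6) (by omega)
  -- KS with provenance from the Gross witness (W-UP′ = `⟨n, d, hn, hKoly, hPn⟩`), `L := 2(M₀+6)`, margin `1`
  obtain ⟨R, Mr, hMr, hMr0, hMrR, hOdd, hEven⟩ := kolyvaginSuppliesAtTwo_of_grossWitness_onHabitat_pred W hQ2 hcm hneg hT hsurN' hIQ
    hodd h3 hHe hsq1 hsq2 h2v hNv hmult τ hτ Dt β ι d₁ M₀ hdiv hndiv (L := 2 * (M₀ + 6)) (k := 1) (by omega) le_rfl hn hKoly d hPn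
  -- the K-side capstone with `rank ≤ 1` displayed (gk2-p2's p737814 re-cut, p741898)
  refine pow_dvd_natCard_sha_of_kolyvaginSupplies_of_orthogonal_of_rank_le_one hQ2 W hcm hT K hIQ hodd h3 hHe hrk hρ Dt β ι d₁ hy M₀ hndiv
    τ hτ (2 * (M₀ + 6)) (M₀ + 6) (by omega) (by omega)
    (fun ℓ ↦ 2 * (M₀ + 6) + 1 ≤ Zhang2014.kolyvaginIndex W 2 ℓ ∧ FrobEqFrobInfty W K (2 ^ (2 * (M₀ + 6) + 1)) ℓ)
    (fun ℓ ↦ 2 * (M₀ + 6) + 1 ≤ Zhang2014.kolyvaginIndex W 2 ℓ ∧ FrobEqFrobInfty W K (2 ^ (2 * (M₀ + 6) + 1)) ℓ)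
    B hker (fun x x' hx hx' ↦ ?_) R Mr hMr hMr0 hMrR hOdd hEven
  -- X-ORTH in provenance currency: drop the margin, descend the Frobenius clause one level
  obtain ⟨n₁, e₁, j₁, hn₁, hKol₁, hj₁, hsel₁, hvan₁, hsg₁, hx₁⟩ := hx
  obtain ⟨n₂, e₂, j₂, hn₂, hKol₂, hj₂, hsel₂, hvan₂, hsg₂, hx₂⟩ := hx'
  exact hOrth x x'
    ⟨n₁, e₁, j₁, hn₁, fun ℓ hℓ ↦ ⟨(hKol₁ ℓ hℓ).1, (hKol₁ ℓ hℓ).2.1, frobEqFrobInfty_pow_of_margin W K (hKol₁ ℓ hℓ).2.2.2⟩,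
      hj₁, hsel₁, hvan₁, hsg₁, hx₁⟩
    ⟨n₂, e₂, j₂, hn₂, fun ℓ hℓ ↦ ⟨(hKol₂ ℓ hℓ).1, (hKol₂ ℓ hℓ).2.1, frobEqFrobInfty_pow_of_margin W K (hKol₂ ℓ hℓ).2.2.2⟩,
      hj₂, hsel₂, hvan₂, hsg₂, hx₂⟩

end Summit.BirchSwinnertonDyer.BirchSwinnertonDyer.Theorems

end
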